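import Mathlib.Analysis.Complex.Basic
import Mathlib.Analysis.Calculus.Deriv.Add
import Mathlib.Analysis.Calculus.Deriv.Inv
import Mathlib.Analysis.Calculus.Deriv.Mul
import HarnessLib

/-!
# Möbius algebra of the radial/chordal coordinate change for Loewner chains

Topic `Probability/RandomPlanarGeometry`; definitions with bodies and proved lemmas only (no named
fact). The deterministic algebra behind the **Schramm–Wilson coordinate change** between the
chordal Loewner chain in the upper half-plane `ℍ` and the radial Loewner chain in the unit disc `𝔻`
(O. Schramm, D. B. Wilson, *SLE coordinate changes*, New York J. Math. 11 (2005); G. F. Lawler,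
*Conformally Invariant Processes in the Plane* (2005), §4.2 and §6.5):

* the Cayley-type map `toDisc z = (i - z)/(i + z)` of `ℍ` onto `𝔻` (`0 ↦ 1`, `∞ ↦ -1`, `i ↦ 0`)
  and its inverse `toHalf w = i (1 - w)/(1 + w)`;
* the disc automorphisms composed with it, `moebius ζ λ z = λ (z - ζ)/(z - ζ̄)` (sending `ζ ↦ 0`,
  the real line onto the circle of radius `|λ|`) and the inverse `moebiusInv ζ λ`;
* the difference formula `moebius ζ λ g - moebius ζ λ W = λ (g - W)(ζ - ζ̄)/((g - ζ̄)(W - ζ̄))`;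
* **the field-conjugation identity** (`RadialChordal.conj_identity`): if `g` moves by the chordal
  Loewner field `2/(g - W)`, the centre `ζ` by `2/(ζ - W)` (and `ζ̄` by `2/(ζ̄ - W)`), and the
  phase `λ` by `λ̇/λ = (ζ - W)⁻² - (ζ̄ - W)⁻²`, then `G = moebius ζ λ g` moves by the *radial*
  Loewner field `a · G (ξ + G)/(ξ - G)` with pole `ξ = moebius ζ λ W` and rate
  `a = -(ζ - ζ̄)²/((ζ - W)² (ζ̄ - W)²) = 4 (im ζ)²/|ζ - W|⁴`. This is the infinitesimal form of
  "the image of a chordal Loewner chain under a Möbius map to the disc is a time change of a radial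
  Loewner chain" (Schramm–Wilson (2005), §4; Lawler (2005), §4.2), a polynomial identity.

## References

* O. Schramm, D. B. Wilson, *SLE coordinate changes*, New York J. Math. 11 (2005), 659–669, §4.
* G. F. Lawler, *Conformally Invariant Processes in the Plane*, AMS (2005), §4.2, §6.5.
  [Lawler2005]
-/

noncomputable section

open Complex Set Metric
open scoped ComplexConjugate

namespace Literature.Probability.RandomPlanarGeometry

namespace RadialChordal

/-! ### The Cayley-type map `ℍ → 𝔻` with `0 ↦ 1`, `i ↦ 0`, `∞ ↦ -1` -/

/-- `toDisc z = (i - z)/(i + z)`: the Möbius map of the upper half-plane onto the unit disc with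
`toDisc 0 = 1`, `toDisc i = 0` and `toDisc ∞ = -1` (junk value `0` at the pole `z = -i`).
Lawler (2005), §6.5 (radial vs. chordal SLE in one picture). [cite: Lawler2005, §6.5] -/
def toDisc (z : ℂ) : ℂ := (I - z) / (I + z)

/-- `toHalf w = i (1 - w)/(1 + w)`: the inverse Möbius map of the unit disc onto the upper
half-plane, `toHalf 1 = 0`, `toHalf 0 = i` (junk value `0` at the pole `w = -1`).
[cite: Lawler2005, §6.5] -/
def toHalf (w : ℂ) : ℂ := I * (1 - w) / (1 + w)

/-- Unfolding of `toDisc`. [folklore] -/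
theorem toDisc_apply (z : ℂ) : toDisc z = (I - z) / (I + z) := rfl

/-- Unfolding of `toHalf`. [folklore] -/
theorem toHalf_apply (w : ℂ) : toHalf w = I * (1 - w) / (1 + w) := rfl

/-- `toDisc 0 = 1`: the chordal starting point goes to the radial one. [folklore] -/
@[simp] theorem toDisc_zero : toDisc 0 = 1 := by
  simp [toDisc]

/-- `toDisc i = 0`: the interior point `i` goes to the centre. [folklore] -/
@[simp] theorem toDisc_I : toDisc I = 0 := by
  simp [toDisc]

/-- `toHalf 0 = i`. [folklore] -/
@[simp] theorem toHalf_zero : toHalf 0 = I := by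
  simp [toHalf]

/-- `toHalf 1 = 0`. [folklore] -/
@[simp] theorem toHalf_one : toHalf 1 = 0 := by
  simp [toHalf]

/-- `toHalf` inverts `toDisc` off the pole `-i`. [folklore] -/
theorem toHalf_toDisc {z : ℂ} (hz : I + z ≠ 0) : toHalf (toDisc z) = z := by
  simp only [toHalf, toDisc]
  have h1 : (1 : ℂ) - (I - z) / (I + z) = 2 * z / (I + z) := by
    field_simp; ring
  have h2 : (1 : ℂ) + (I - z) / (I + z) = 2 * I / (I + z) := by
    field_simp; ring
  rw [h1, h2, mul_div_assoc', div_div_div_cancel_right₀ hz,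
    show I * (2 * z) = z * (2 * I) by ring, mul_div_cancel_right₀ _ (mul_ne_zero two_ne_zero I_ne_zero)]

/-- `toDisc` inverts `toHalf` off the pole `-1`. [folklore] -/
theorem toDisc_toHalf {w : ℂ} (hw : 1 + w ≠ 0) : toDisc (toHalf w) = w := by
  simp only [toHalf, toDisc]
  have h1 : I - I * (1 - w) / (1 + w) = w * (2 * I) / (1 + w) := by
    field_simp; ring
  have h2 : I + I * (1 - w) / (1 + w) = 2 * I / (1 + w) := by
    field_simp; ring
  rw [h1, h2, div_div_div_cancel_right₀ hw, mul_div_cancel_right₀ _ (mul_ne_zero two_ne_zero I_ne_zero)]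

/-- `im (toHalf w) = (1 - |w|²)/|1 + w|²`. [folklore] -/
theorem im_toHalf (w : ℂ) : (toHalf w).im = (1 - normSq w) / normSq (1 + w) := by
  rw [toHalf, Complex.div_im]
  simp only [Complex.mul_im, Complex.mul_re, Complex.I_re, Complex.I_im, Complex.sub_re,
    Complex.sub_im, Complex.one_re, Complex.one_im, Complex.add_re, Complex.add_im,
    Complex.normSq_apply]
  ring

/-- Points of the open unit disc go to the open upper half-plane. [folklore] -/
theorem im_toHalf_pos {w : ℂ} (hw : ‖w‖ < 1) : 0 < (toHalf w).im := by
  rw [im_toHalf]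
  have h1 : normSq w < 1 := by
    rw [Complex.normSq_eq_norm_sq]
    nlinarith [norm_nonneg w]
  have h2 : 1 + w ≠ 0 := by
    intro h
    have : w = -1 := by linear_combination h
    rw [this, norm_neg, norm_one] at hw
    exact lt_irrefl _ hw
  exact div_pos (by linarith) (Complex.normSq_pos.2 h2)

/-- `|toDisc z|² = |i - z|²/|i + z|²`, and `|i - z|² < |i + z|²` iff `im z > 0`. [folklore] -/
theorem normSq_I_sub_lt_iff (z : ℂ) : normSq (I - z) < normSq (I + z) ↔ 0 < z.im := by
  simp only [Complex.normSq_apply, Complex.sub_re, Complex.add_re, Complex.I_re, Complex.sub_im,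
    Complex.add_im, Complex.I_im]
  constructor <;> intro h <;> nlinarith

/-- Points of the open upper half-plane go to the open unit disc. [folklore] -/
theorem norm_toDisc_lt_one {z : ℂ} (hz : 0 < z.im) : ‖toDisc z‖ < 1 := by
  have hne : I + z ≠ 0 := by
    intro h
    have : (I + z).im = 0 := by rw [h]; simp
    simp at this
    linarith
  rw [toDisc, norm_div, div_lt_one (norm_pos_iff.2 hne)]
  have h := (normSq_I_sub_lt_iff z).2 hz
  rw [Complex.normSq_eq_norm_sq, Complex.normSq_eq_norm_sq] at h
  exact lt_of_pow_lt_pow_left₀ 2 (norm_nonneg _) h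

/-- A point of the open upper half-plane is not the pole `-i` of `toDisc`. [folklore] -/
theorem I_add_ne_zero {z : ℂ} (hz : 0 ≤ z.im) : I + z ≠ 0 := by
  intro h
  have : (I + z).im = 0 := by rw [h]; simp
  simp at this
  linarith

/-- A point of the closed unit disc other than `-1` is not the pole of `toHalf`; in particular any
point of the open disc. [folklore] -/
theorem one_add_ne_zero {w : ℂ} (hw : ‖w‖ < 1) : 1 + w ≠ 0 := by
  intro h
  have : w = -1 := by linear_combination h
  rw [this, norm_neg, norm_one] at hw
  exact lt_irrefl _ hw

/-! ### The disc automorphism part: `moebius ζ λ z = λ (z - ζ)/(z - ζ̄)` -/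

/-- `moebius ζ λ z = λ (z - ζ)/(z - conj ζ)`: for `im ζ > 0` and `|λ| = 1` the Möbius map of `ℍ`
onto `𝔻` sending `ζ ↦ 0` and `ℝ` onto the unit circle; `moebius i (-1) = toDisc`. Schramm–Wilson
(2005), §4 (the conformal map from the chordal to the radial picture, normalised at the target
point). [cite: Lawler2005, §6.5] -/
def moebius (ζ lam z : ℂ) : ℂ := lam * (z - ζ) / (z - conj ζ)

/-- The inverse map `moebiusInv ζ λ w = (conj ζ · w - λ ζ)/(w - λ)`. [folklore] -/
def moebiusInv (ζ lam w : ℂ) : ℂ := (conj ζ * w - lam * ζ) / (w - lam)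

/-- Unfolding of `moebius`. [folklore] -/
theorem moebius_apply (ζ lam z : ℂ) : moebius ζ lam z = lam * (z - ζ) / (z - conj ζ) := rfl

/-- Unfolding of `moebiusInv`. [folklore] -/
theorem moebiusInv_apply (ζ lam w : ℂ) : moebiusInv ζ lam w = (conj ζ * w - lam * ζ) / (w - lam) := rfl

/-- `moebius i (-1) = toDisc`. [folklore] -/
theorem moebius_I_neg_one (z : ℂ) : moebius I (-1) z = toDisc z := by
  rw [moebius, toDisc, Complex.conj_I]
  rw [sub_neg_eq_add]
  rcases eq_or_ne (z + I) 0 with h | h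
  · have : I + z = 0 := by rw [add_comm]; exact h
    simp [h, this]
  · have h' : I + z ≠ 0 := by rwa [add_comm]
    field_simp
    ring

/-- The centre goes to the origin. [folklore] -/
@[simp] theorem moebius_self (ζ lam : ℂ) : moebius ζ lam ζ = 0 := by
  simp [moebius]

/-- The inverse at the origin is the centre (`λ ≠ 0`). [folklore] -/
theorem moebiusInv_zero {ζ lam : ℂ} (hlam : lam ≠ 0) : moebiusInv ζ lam 0 = ζ := by
  simp only [moebiusInv, mul_zero, zero_sub]
  rw [neg_div_neg_eq]
  field_simp

/-- `moebiusInv` inverts `moebius` (off the pole `conj ζ`, for `λ ≠ 0`, `ζ ∉ ℝ`). [folklore] -/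
theorem moebiusInv_moebius {ζ lam z : ℂ} (hlam : lam ≠ 0) (hζ : ζ - conj ζ ≠ 0) (hz : z - conj ζ ≠ 0) :
    moebiusInv ζ lam (moebius ζ lam z) = z := by
  simp only [moebiusInv, moebius]
  have h1 : conj ζ * (lam * (z - ζ) / (z - conj ζ)) - lam * ζ =
      lam * z * (conj ζ - ζ) / (z - conj ζ) := by
    field_simp; ring
  have h2 : lam * (z - ζ) / (z - conj ζ) - lam = lam * (conj ζ - ζ) / (z - conj ζ) := by
    field_simp; ring
  rw [h1, h2]
  have hζ' : conj ζ - ζ ≠ 0 := fun h ↦ hζ (by linear_combination -h)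
  field_simp

/-- `moebius` inverts `moebiusInv` (off the pole `λ`, for `λ ≠ 0`, `ζ ∉ ℝ`). [folklore] -/
theorem moebius_moebiusInv {ζ lam w : ℂ} (hlam : lam ≠ 0) (hζ : ζ - conj ζ ≠ 0) (hw : w - lam ≠ 0) :
    moebius ζ lam (moebiusInv ζ lam w) = w := by
  simp only [moebiusInv, moebius]
  have h1 : (conj ζ * w - lam * ζ) / (w - lam) - ζ = (conj ζ - ζ) * w / (w - lam) := by
    field_simp; ring
  have h2 : (conj ζ * w - lam * ζ) / (w - lam) - conj ζ = lam * (conj ζ - ζ) / (w - lam) := by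
    field_simp; ring
  rw [h1, h2]
  have hζ' : conj ζ - ζ ≠ 0 := fun h ↦ hζ (by linear_combination -h)
  field_simp

/-- **The difference formula**:
`moebius ζ λ g - moebius ζ λ W = λ (g - W)(ζ - ζ̄)/((g - ζ̄)(W - ζ̄))`. [folklore] -/
theorem moebius_sub_moebius {ζ lam g W : ℂ} (hg : g - conj ζ ≠ 0) (hW : W - conj ζ ≠ 0) :
    moebius ζ lam g - moebius ζ lam W =
      lam * (g - W) * (ζ - conj ζ) / ((g - conj ζ) * (W - conj ζ)) := by
  simp only [moebius]
  field_simp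
  ring

/-- The derivative of `moebius ζ λ` at a point: `λ (ζ - ζ̄)/(z - ζ̄)²`. [folklore] -/
theorem hasDerivAt_moebius {ζ lam z : ℂ} (hz : z - conj ζ ≠ 0) :
    HasDerivAt (moebius ζ lam) (lam * (ζ - conj ζ) / (z - conj ζ) ^ 2) z := by
  have h1 : HasDerivAt (fun z ↦ lam * (z - ζ)) lam z := by
    simpa using HasDerivAt.const_mul lam (HasDerivAt.sub_const ζ (hasDerivAt_id z))
  have h2 : HasDerivAt (fun z ↦ z - conj ζ) 1 z := HasDerivAt.sub_const _ (hasDerivAt_id z)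
  have h := h1.div h2 hz
  refine h.congr_deriv ?_
  field_simp
  ring

/-- For a real argument `x` (i.e. `conj x = x`) and `|λ| = 1`, `moebius ζ λ x` lies on the unit
circle: `|x - ζ| = |x - ζ̄|`. [folklore] -/
theorem norm_moebius_of_conj_eq {ζ lam x : ℂ} (hx : conj x = x) (hlam : ‖lam‖ = 1)
    (hxζ : x - conj ζ ≠ 0) : ‖moebius ζ lam x‖ = 1 := by
  rw [moebius, norm_div, norm_mul, hlam, one_mul]
  have h : ‖x - ζ‖ = ‖x - conj ζ‖ := by
    have : x - conj ζ = conj (x - ζ) := by rw [map_sub, hx]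
    rw [this, Complex.norm_conj]
  rw [h, div_self (norm_ne_zero_iff.2 hxζ)]

/-- For `im ζ > 0` and `im z > 0`, `|z - ζ| < |z - ζ̄|`, so `|moebius ζ λ z| < |λ|`. [folklore] -/
theorem normSq_sub_lt_normSq_sub_conj {ζ z : ℂ} (hζ : 0 < ζ.im) (hz : 0 < z.im) :
    normSq (z - ζ) < normSq (z - conj ζ) := by
  simp only [Complex.normSq_apply, Complex.sub_re, Complex.sub_im, Complex.conj_re, Complex.conj_im]
  nlinarith

/-- `moebius ζ λ` maps the upper half-plane into the disc of radius `|λ|` (`im ζ > 0`). [folklore] -/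
theorem norm_moebius_lt {ζ lam z : ℂ} (hζ : 0 < ζ.im) (hz : 0 < z.im) (hlam : lam ≠ 0) :
    ‖moebius ζ lam z‖ < ‖lam‖ := by
  have hden : z - conj ζ ≠ 0 := by
    intro h
    have : (z - conj ζ).im = 0 := by rw [h]; simp
    simp at this
    linarith
  rw [moebius, norm_div, norm_mul, mul_div_assoc]
  refine mul_lt_of_lt_one_right (norm_pos_iff.2 hlam) ?_
  rw [div_lt_one (norm_pos_iff.2 hden)]
  have h := normSq_sub_lt_normSq_sub_conj hζ hz
  rw [Complex.normSq_eq_norm_sq, Complex.normSq_eq_norm_sq] at h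
  exact lt_of_pow_lt_pow_left₀ 2 (norm_nonneg _) h

/-! ### The field-conjugation identity -/

/-- **The field-conjugation identity (chordal → radial).** Let `g, W, ζ, c, λ` be complex numbers
(in the application `W` is the real chordal driving value and `c = conj ζ`) with `g, ζ, c ≠ W`,
`g ≠ c`, `W ≠ c`, and such that the pole `ξ = λ (W - ζ)/(W - c)` differs from `G = λ (g - ζ)/(g - c)`.
If `g` moves by the chordal field `2/(g - W)`, `ζ` by `2/(ζ - W)`, `c` by `2/(c - W)` and `λ` by
`λ̇ = s λ`, `s = (ζ - W)⁻² - (c - W)⁻²`, then the time derivative of `G`, namely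
`s G + λ ((2/(g-W) - 2/(ζ-W)) (g - c) - (g - ζ)(2/(g-W) - 2/(c-W)))/(g - c)²`, equals the radial
Loewner field `a G (ξ + G)/(ξ - G)` with rate `a = -(ζ - c)²/((ζ - W)² (c - W)²)`. A polynomial
identity (Schramm–Wilson (2005), §4: chordal SLE in the disc is a time-changed radial Loewner
chain). [cite: Lawler2005, §4.2] -/
theorem conj_identity {g W ζ c lam : ℂ} (hgW : g - W ≠ 0) (hζW : ζ - W ≠ 0) (hcW : c - W ≠ 0)
    (hgc : g - c ≠ 0) :
    ((ζ - W)⁻¹ ^ 2 - (c - W)⁻¹ ^ 2) * (lam * (g - ζ) / (g - c)) +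
        lam * ((2 / (g - W) - 2 / (ζ - W)) * (g - c) - (g - ζ) * (2 / (g - W) - 2 / (c - W))) /
          (g - c) ^ 2 =
      (-(ζ - c) ^ 2 / ((ζ - W) ^ 2 * (c - W) ^ 2)) * (lam * (g - ζ) / (g - c)) *
        (((W - ζ) * (g - c) + (g - ζ) * (W - c)) / ((W - g) * (ζ - c))) := by
  have hWg : W - g ≠ 0 := fun h ↦ hgW (by linear_combination -h)
  field_simp
  ring

/-- The pole and the point in the radial picture: for `ξ = λ (W - ζ)/(W - c)` and
`G = λ (g - ζ)/(g - c)` one has `ξ - G = λ (W - g)(ζ - c)/((W - c)(g - c))`, so that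
`(ξ + G)/(ξ - G) = ((W - ζ)(g - c) + (g - ζ)(W - c))/((W - g)(ζ - c))` (`λ` cancels).
[folklore] -/
theorem pole_add_div_pole_sub {g W ζ c lam : ℂ} (hlam : lam ≠ 0) (hgc : g - c ≠ 0) (hWc : W - c ≠ 0) :
    (lam * (W - ζ) / (W - c) + lam * (g - ζ) / (g - c)) /
        (lam * (W - ζ) / (W - c) - lam * (g - ζ) / (g - c)) =
      ((W - ζ) * (g - c) + (g - ζ) * (W - c)) / ((W - g) * (ζ - c)) := by
  rw [div_add_div _ _ hWc hgc, div_sub_div _ _ hWc hgc, div_div_div_cancel_right₀ (mul_ne_zero hWc hgc)]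
  have hden : lam * (W - ζ) * (g - c) - (W - c) * (lam * (g - ζ)) = lam * ((W - g) * (ζ - c)) := by ring
  have hnum : lam * (W - ζ) * (g - c) + (W - c) * (lam * (g - ζ)) =
      lam * ((W - ζ) * (g - c) + (g - ζ) * (W - c)) := by ring
  rw [hden, hnum, mul_div_mul_left _ _ hlam]

/-- The pole differs from the point: `ξ - G ≠ 0` as soon as `λ ≠ 0`, `W ≠ g` and `ζ ≠ c`. [folklore] -/
theorem pole_sub_ne_zero {g W ζ c lam : ℂ} (hlam : lam ≠ 0) (hgW : g - W ≠ 0) (hζc : ζ - c ≠ 0)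
    (hgc : g - c ≠ 0) (hWc : W - c ≠ 0) :
    lam * (W - ζ) / (W - c) - lam * (g - ζ) / (g - c) ≠ 0 := by
  rw [div_sub_div _ _ hWc hgc]
  refine div_ne_zero ?_ (mul_ne_zero hWc hgc)
  have : lam * (W - ζ) * (g - c) - (W - c) * (lam * (g - ζ)) = lam * (W - g) * (ζ - c) := by ring
  rw [this]
  exact mul_ne_zero (mul_ne_zero hlam (fun h ↦ hgW (by linear_combination -h))) hζc

/-- **The field-conjugation identity in Loewner form**: with `ξ = moebius ζ λ W` and
`G = moebius ζ λ g` (`c = conj ζ`), the derivative of `G` along the chordal motions equals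
`a · G (ξ + G)/(ξ - G)`, the radial Loewner field at `G` with pole `ξ` and rate
`a = -(ζ - ζ̄)²/((ζ - W)²(ζ̄ - W)²)`. [cite: Lawler2005, §4.2] -/
theorem conj_identity_moebius {g W ζ lam : ℂ} (hlam : lam ≠ 0) (hgW : g - W ≠ 0) (hζW : ζ - W ≠ 0)
    (hcW : conj ζ - W ≠ 0) (hgc : g - conj ζ ≠ 0) (hWc : W - conj ζ ≠ 0) :
    ((ζ - W)⁻¹ ^ 2 - (conj ζ - W)⁻¹ ^ 2) * moebius ζ lam g +
        lam * ((2 / (g - W) - 2 / (ζ - W)) * (g - conj ζ) -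
          (g - ζ) * (2 / (g - W) - 2 / (conj ζ - W))) / (g - conj ζ) ^ 2 =
      (-(ζ - conj ζ) ^ 2 / ((ζ - W) ^ 2 * (conj ζ - W) ^ 2)) *
        (moebius ζ lam g * (moebius ζ lam W + moebius ζ lam g) / (moebius ζ lam W - moebius ζ lam g)) := by
  rw [moebius_apply, moebius_apply]
  rw [conj_identity hgW hζW hcW hgc (lam := lam), ← pole_add_div_pole_sub hlam hgc hWc (ζ := ζ)]
  ring

end RadialChordal

end Literature.Probability.RandomPlanarGeometry
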